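import Mathlib

/-!
# Rank certificates for the line-functional reduction of perturbed multipartite clique complexes (DEQ-A07B)

HONEST FRAMING: instance-level adjudication of specific advantage claims; no claim about
BQP vs BPP or the summit.

Context (cell pub-qadeq, claim A-07 = Berry et al., "Analyzing prospects for quantum advantage in
topological data analysis", arXiv:2209.13581v3 / PRX Quantum 5, 010319: §4.1, the perturbed
complete-`k`-partite family `G = K(m,k) - D`; residual O2 of OPEN-1, "beyond the apex regime").
DEQ-A07B.md (unit pub-qadeq-deq-1) proves that for ANY reference transversal `R`
`β_{k-1}(Cl(G)) = N(G,R) - rank Λ_R`, where `N(G,R)` counts the `k`-cliques avoiding `R` and `Λ_R` is an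
explicit finite family of 0/1 "line" and "plane" functionals on `ℝ^{N(G,R)}` (Theorems I–II), and then
certifies `rank Λ_R` from both sides by locally checkable counts (Corollary III):

* from below by functionals owning a PRIVATE coordinate (and, more finely, by grid blocks) —
  `card_le_rank_of_private_pivots` below is exactly that step for an arbitrary matrix over a field;
* from above by explicit DEPENDENCIES with pairwise disjoint supports (one per conflict-free doubly
  flagged grid) — `rank_add_le_card_of_vecMul_eq_zero` with
  `linearIndependent_of_disjoint_supports` below.

Everything is `[folklore]` linear algebra over Mathlib; no named fact, no axiom, no `def`.
The combinatorial identification of `ker ∂_{k-1}` with marginal-free tensors (Theorem I), the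
reference-coordinate isomorphism (Theorem II) and the sampling estimator (Corollary IV) are proved on
paper in DEQ-A07B.md §3 and checked by two independent implementations in NUMERICS-A07B.md.
-/

namespace Summit.QuantumAdvantage.Dequantization.MultipartiteLineRank

open Matrix

variable {K : Type*} [Field K] {ι κ : Type*}

/-- Rows owning private pivot columns are linearly independent: if every row `i ∈ S` is non-zero at a
column `piv i` where all other rows of `M` vanish, then the rows indexed by `S` are independent. -/
theorem linearIndependent_rows_of_private_pivots (M : Matrix ι κ K) (S : Finset ι) (piv : ι → κ)
    (h : ∀ i ∈ S, M i (piv i) ≠ 0 ∧ ∀ j, j ≠ i → M j (piv i) = 0) :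
    LinearIndependent K (fun i : S => M i) := by
  classical
  rw [Fintype.linearIndependent_iff]
  intro g hg i
  have hi := h i i.property
  have key := congrArg (fun v : κ → K => v (piv i)) hg
  simp only [Finset.sum_apply, Pi.smul_apply, smul_eq_mul, Pi.zero_apply] at key
  rw [Finset.sum_eq_single i] at key
  · exact (mul_eq_zero.mp key).resolve_right hi.1
  · intro j _ hji
    have : (j : ι) ≠ i := fun e => hji (Subtype.ext e)
    simp [hi.2 j this]
  · intro hni; exact absurd (Finset.mem_univ i) hni

/-- **Private-pivot certificate** (DEQ-A07B, Corollary III, lower bound on the rank).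
If the rows in `S` own private pivot columns then `S.card ≤ rank M`.  Applied to the matrix of the
family `Λ_R`: (number of functionals with a private coordinate) `≤ rank Λ_R`, i.e.
`β_{k-1} ≤ N(G,R) - #settled`. -/
theorem card_le_rank_of_private_pivots [Fintype ι] [Fintype κ] (M : Matrix ι κ K) (S : Finset ι)
    (piv : ι → κ) (h : ∀ i ∈ S, M i (piv i) ≠ 0 ∧ ∀ j, j ≠ i → M j (piv i) = 0) :
    S.card ≤ M.rank := by
  classical
  have hli := linearIndependent_rows_of_private_pivots M S piv h
  rw [Matrix.rank_eq_finrank_span_row]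
  have h1 : Module.finrank K (Submodule.span K (Set.range fun i : S => M i)) = S.card := by
    rw [finrank_span_eq_card hli, Fintype.card_coe]
  have h2 : Submodule.span K (Set.range fun i : S => M i) ≤ Submodule.span K (Set.range M.row) := by
    apply Submodule.span_mono
    rintro _ ⟨i, rfl⟩
    exact ⟨i, rfl⟩
  calc S.card = Module.finrank K (Submodule.span K (Set.range fun i : S => M i)) := h1.symm
    _ ≤ Module.finrank K (Submodule.span K (Set.range M.row)) := Submodule.finrank_mono h2

/-- Non-zero vectors with pairwise disjoint supports are linearly independent. -/
theorem linearIndependent_of_disjoint_supports {t : ℕ} (v : Fin t → ι → K)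
    (hne : ∀ i, v i ≠ 0) (hdis : ∀ i j, i ≠ j → ∀ x, v i x = 0 ∨ v j x = 0) :
    LinearIndependent K v := by
  classical
  rw [Fintype.linearIndependent_iff]
  intro g hg i
  obtain ⟨x, hx⟩ : ∃ x, v i x ≠ 0 := Function.ne_iff.mp (hne i)
  have key := congrArg (fun w : ι → K => w x) hg
  simp only [Finset.sum_apply, Pi.smul_apply, smul_eq_mul, Pi.zero_apply] at key
  rw [Finset.sum_eq_single i] at key
  · exact (mul_eq_zero.mp key).resolve_right hx
  · intro j _ hji
    rcases hdis j i hji x with h0 | h0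
    · simp [h0]
    · exact absurd h0 hx
  · intro hni; exact absurd (Finset.mem_univ i) hni

/-- **Dependency certificate** (DEQ-A07B, Corollary III, upper bound on the rank).
`t` linearly independent left-kernel vectors (`c ᵥ* M = 0`) force `rank M + t ≤ card ι`.  In DEQ-A07B the
vectors are the grid dependencies `Σ_v λ_{a,h''+v} - Σ_u λ_{b,h''+u} = 0` of conflict-free doubly flagged
grids, which have pairwise disjoint supports, whence `rank Λ_R ≤ |Λ_R| - G2free` and
`β_{k-1} ≥ N(G,R) - |Λ_R| + G2free`. -/
theorem rank_add_le_card_of_vecMul_eq_zero [Fintype ι] [Fintype κ] (M : Matrix ι κ K) {t : ℕ}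
    (c : Fin t → ι → K) (hli : LinearIndependent K c) (hker : ∀ i, c i ᵥ* M = 0) :
    M.rank + t ≤ Fintype.card ι := by
  classical
  -- rank M = rank Mᵀ = finrank (range Mᵀ.mulVecLin); rank–nullity for Mᵀ.mulVecLin : (ι → K) → (κ → K)
  have hrn := LinearMap.finrank_range_add_finrank_ker (Mᵀ.mulVecLin)
  rw [Module.finrank_fintype_fun_eq_card] at hrn
  have hrank : M.rank = Module.finrank K (LinearMap.range Mᵀ.mulVecLin) := by
    rw [← Matrix.rank_transpose]; rfl
  -- the span of the `c i` sits inside the kernel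
  have hsub : Submodule.span K (Set.range c) ≤ LinearMap.ker Mᵀ.mulVecLin := by
    rw [Submodule.span_le]
    rintro _ ⟨i, rfl⟩
    simp only [SetLike.mem_coe, LinearMap.mem_ker, Matrix.mulVecLin_apply, Matrix.mulVec_transpose]
    exact hker i
  have ht : Module.finrank K (Submodule.span K (Set.range c)) = t := by
    rw [finrank_span_eq_card hli, Fintype.card_fin]
  have hmono := Submodule.finrank_mono hsub
  rw [ht] at hmono
  omega

end Summit.QuantumAdvantage.Dequantization.MultipartiteLineRank
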